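import Summits.BirchSwinnertonDyer.BirchSwinnertonDyer.Theorems.SignedLowerHalvesKobayashiLowerHalfSemistableDefmuMuCarrierStubs
import Literature.NumberTheory.Automorphic.DefiniteOrderUnitsCardDvd
import HarnessLib

/-!
# Line «defmu» of crux 2 `KobayashiLowerHalfSemistable` (stmt-BirchSwinnertonDyer-19000), skeleton v4: Pollack–Weston's
# Lemma 2.1 normalisation is AUTOMATIC at `p ≥ 5` for a generator of the eigen-line (PROVED), so the definite `μ`-carrier
# of Cμ′ drops that conjunct; the crux BODY from the five v4 stub signatures

Route-independent `Theorems` file of the cell `bsd-ssimc`, seat `bsd-line-slh-p2` (LEAD of crux 2, gen 13); third file of the v3/v4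
reshape after `…SemistableDefmuMuCarrier.lean` (p637155) and `…SemistableDefmuMuCarrierStubs.lean` (p637545). HONEST FRAMING: nothing
about any curve is asserted, NO summit statement is proved, BSD / the crux is NOT proved; every theorem is an IMPLICATION from
hypotheses displayed in full, except the two lemmas of §1, which are unconditional commutative algebra.

§1 (PROVED, unconditional). The typed fact `pollackWeston2011_thm_2_5_hasMuZeroLAc` keeps Pollack–Weston's normalisation of
`ψ_f = ⟨·, g_f⟩` ("we can and do insist that `1` be in the image of `ψ_f`", their Lemma 2.1) as the explicit hypothesis
`∃ c, ¬ p ∣ w_c φ_c`. For a generator `φ` of the eigen-LINE `L(λ) = ℤ φ` (a saturated sub-lattice of `ℤ^{Cls O}`: it is cut out by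
linear equations) NO integer non-unit divides every coordinate of `φ` (`exists_not_dvd_apply_of_eigenLattice_eq_span`: if `φ = d ψ`
then `ψ ∈ L(λ) = ℤ φ`, so `ψ = k φ`, `(dk − 1) φ = 0`, `dk = 1`); and the Brandt weights divide `12` (the tree's THEOREM
`Brandt.XiSetup.weight_dvd_twelve`), so for a prime `p ≥ 5` some `w_c φ_c` is prime to `p`
(`exists_not_dvd_weight_mul_apply`). Hence at the line's datum (`5 ≤ p`) the v3 carrier conjunct `∃ c, ¬ p ∣ w_c φ_c` is REDUNDANT.

§2. Skeleton v4 = v3 with that conjunct removed from `stub_definitePackageMuCarrier` (Cμ′ is now: a Brandt setup `S` of type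
`(N/q₀, q₀)`, a generator `φ ≠ 0` of the `a(W)`-eigen-line, a tower `T`, with `T.HasMuZeroLAc p φ → HasUnitContent (UnrSeries₂.minus Lsig)`
— closer to the printed sentence of BSTW-II §2.2.2 (def), which mentions no normalisation). `exists_package_of_muCarrier` (v4 form:
the normalisation supplied by §1 from `5 ≤ p`) and `kobayashiLowerHalfSemistable_body_of_stubs₅` (the route decl's BODY from the five v4
signatures verbatim, via p637545's ingredients p630247 / p629660) are the composition target of `Lines/defmu.lean` v4.

Stub ledger of v4 (numbers, not adjectives): unchanged from v3 — hypotheses 6 · proved 1 (S1bʳ) · PUB-conditional 2 (S1aʳ; `acMuInput`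
NAMED) · PRE 2 (Cμ′, NamedInputs₂) · residual 1 (S7) · registered sorries 5 · kernel-closable today 0. Kernel state of the crux:
UNCHANGED (OPEN; PRE). Nothing of BSTW is asserted.

References: [PollackWeston2011] Compos. Math. 147 (2011) §2.1 (ψ_f, g_f, Lemma 2.1), Thm. 2.5 (i); [Voight2021] 41.1.3 (weights);
[BurungaleSkinnerTianWan2024] arXiv:2409.01350v2 II §2.2.2 (proof, case (def)); cell files `Cruxes/KobayashiLowerHalfSemistable/{Lines/defmu.lean, PICKED.md}`.
-/

-- D-0017: single-problem summit, the namespace repeats the problem name by design.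
set_option linter.dupNamespace false
set_option autoImplicit false

noncomputable section

open scoped Classical

open NumberField IsDedekindDomain Field CongruenceSubgroup
open Literature.NumberTheory.GaloisRepresentations
open Literature.NumberTheory.EllipticCurves Literature.NumberTheory.EllipticCurves.BurungaleSkinnerTianWan2024
open Literature.NumberTheory.EllipticCurves.ModularForms
open Literature.NumberTheory.Automorphic

namespace Summit.BirchSwinnertonDyer.BirchSwinnertonDyer.Theorems.SemistableDefmuMuCarrierV4

/-! ### §1. The Pollack–Weston normalisation is automatic for a generator of the eigen-line (PROVED) -/

/-- **A generator of the eigen-line is primitive.** If the common eigen-lattice `L(λ) ⊆ ℤ^ι` of a family of integer matrices is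
the line `ℤ φ` with `φ ≠ 0`, then no non-unit `d ∈ ℤ` divides every coordinate of `φ`: from `φ = d ψ` one gets `ψ ∈ L(λ)` (the
defining equations `T(q) v = λ(q) v` can be divided by `d ≠ 0` in the torsion-free `ℤ^ι`), so `ψ = k φ`, `(dk − 1) φ = 0`, `dk = 1`.
(Pollack–Weston §2.1: `g_f` generates `ℳ^f`; "this normalization determines `ψ_f` up to a `p`-adic unit".) [folklore] -/
theorem exists_not_dvd_apply_of_eigenLattice_eq_span {ι : Type*} [Fintype ι] {N : ℕ} {T : ℕ → Matrix ι ι ℤ}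
    {lam : ℕ → ℤ} {φ : ι → ℤ} (hφ0 : φ ≠ 0) (hφ : Brandt.eigenLattice N T lam = ℤ ∙ φ) {d : ℤ}
    (hd : ¬ IsUnit d) : ∃ c, ¬ d ∣ φ c := by
  by_contra h
  simp only [not_exists, not_not] at h
  choose ψ hψ using h
  have hφeq : φ = d • (fun c => ψ c) := funext fun c => by rw [Pi.smul_apply, smul_eq_mul]; exact hψ c
  have hd0 : d ≠ 0 := by
    rintro rfl
    exact hφ0 (by rw [hφeq, zero_smul])
  have hφmem : φ ∈ Brandt.eigenLattice N T lam := by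
    rw [hφ]; exact Submodule.mem_span_singleton_self φ
  have hψmem : (fun c => ψ c) ∈ Brandt.eigenLattice N T lam := by
    rw [Brandt.mem_eigenLattice_iff] at hφmem ⊢
    intro q hq hqN
    have h1 := hφmem q hq hqN
    rw [hφeq, Matrix.mulVec_smul, smul_comm] at h1
    exact smul_right_injective (ι → ℤ) hd0 h1
  rw [hφ, Submodule.mem_span_singleton] at hψmem
  obtain ⟨k, hk⟩ := hψmem
  have hfix : (d * k) • φ = φ := by rw [mul_smul, hk, ← hφeq]
  have hsub : (d * k - 1) • φ = 0 := by rw [sub_smul, one_smul, hfix, sub_self]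
  rcases smul_eq_zero.mp hsub with h0 | h0
  · exact hd (IsUnit.of_mul_eq_one k (sub_eq_zero.mp h0))
  · exact hφ0 h0

/-- **Pollack–Weston's Lemma 2.1 normalisation `∃ c, p ∤ w_c φ_c` holds automatically for `p ≥ 5` and a generator `φ` of the
eigen-line of a Brandt setup:** the weights `w_c = #O_L(I_c)ˣ/2` divide `12` (`Brandt.XiSetup.weight_dvd_twelve`, a THEOREM of the
tree), so `p ∤ w_c`, and some coordinate `φ_c` is prime to `p` (`exists_not_dvd_apply_of_eigenLattice_eq_span`). This is the
hypothesis kept explicit in `pollackWeston2011_thm_2_5_hasMuZeroLAc` ("we can and do insist that `1` be in the image of `ψ_f`",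
`im ψ_f = (w_c φ_c)_c`). [cite: PollackWeston2011, §2.1 Lemma 2.1] [cite: Voight2021, 41.1.3] -/
theorem exists_not_dvd_weight_mul_apply {Nplus Nminus : ℕ} (S : Brandt.XiSetup Nplus Nminus)
    [Fintype (Brandt.ClassSet S.O)] {lam : ℕ → ℤ} {φ : Brandt.ClassSet S.O → ℤ} (hφ0 : φ ≠ 0)
    (hφ : Brandt.eigenLattice (Nplus * Nminus) (Brandt.matrix S.O) lam = ℤ ∙ φ) {p : ℕ} (hp : p.Prime) (h5 : 5 ≤ p) :
    ∃ c : Brandt.ClassSet S.O, ¬ (p : ℤ) ∣ (Brandt.weight S.O c : ℤ) * φ c := by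
  have hpu : ¬ IsUnit (p : ℤ) := by rw [Int.isUnit_iff]; omega
  obtain ⟨c, hc⟩ := exists_not_dvd_apply_of_eigenLattice_eq_span hφ0 hφ hpu
  refine ⟨c, fun h => ?_⟩
  rcases (Nat.prime_iff_prime_int.mp hp).dvd_or_dvd h with hw | hφc
  · have h12 : p ∣ 12 := by
      have h' : (p : ℤ) ∣ ((12 : ℕ) : ℤ) := hw.trans (by exact_mod_cast S.weight_dvd_twelve c)
      exact_mod_cast h'
    have hle : p ≤ 12 := Nat.le_of_dvd (by norm_num) h12
    interval_cases p <;> first | omega | exact absurd hp (by decide)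
  · exact hc hφc

/-! ### §2. Cμ′ (v4 carrier) ⊕ (P4a) ⟹ Cμ, pointwise; the crux BODY from the five v4 stub signatures -/

/-- **The old stub Cμ from the reshaped stub Cμ′ and Pollack–Weston Thm. 2.5, pointwise.** In the binders of
`stub_definitePackageMu` that matter here (`W`, `K`, `p`, `N = N_W`, the definite-CR prime `q₀`, the anticyclotomic data
`κ₁ κ₂ v̄ γ₁ γ₂`, the Greenberg series `G`, the structure map `J`, the sign `ε`): if the signed two-variable package
`(ξ, 𝓛sig)` exists with (P1) the characteristic-ideal identity, (P2)/(P3) the cyclotomic specialisations, and — in place of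
unit content — a DEFINITE `μ`-CARRIER in its v4 form (a Brandt setup `S` of type `(N/q₀, q₀)`, a generator `φ ≠ 0` of the `a(W)`-eigen-line —
no normalisation clause, it is supplied by `exists_not_dvd_weight_mul_apply` from `5 ≤ p` —, a tower `T` of Gross points, with
`T.HasMuZeroLAc p φ → HasUnitContent (UnrSeries₂.minus 𝓛sig)`), then the
package exists WITH `HasUnitContent (UnrSeries₂.minus 𝓛sig)` — the conclusion of Cμ verbatim — GRANTED the named fact
`pollackWeston2011_thm_2_5_hasMuZeroLAc` (`hPW`), applied to that very carrier (p637155's `SemistableDefmuMuCarrier.hasMuZeroLAc_of_pollackWeston`). The printed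
sentence: "(𝓛^{∘,ac}_p(g_{/L})) = (∏ c_q(g) · 𝓛^∘_𝒲(g_{/L})) … and so `μ(𝓛^∘_p(g_{/L})) = 0`". CONDITIONAL; closes nothing.
[cite: BurungaleSkinnerTianWan2024, II §2.2.2 (proof, case (def))] [cite: PollackWeston2011, Thm. 2.5 (i)] -/
theorem exists_package_of_muCarrier
    (hPW : ∀ (K : Type) [Field K] [NumberField K] {Nplus Nminus : ℕ} (S : Brandt.XiSetup Nplus Nminus)
      (p : ℕ) [Fact p.Prime] (W : WeierstrassCurve ℚ), pollackWeston2011_thm_2_5_hasMuZeroLAc K S p W)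
    {p : ℕ} [Fact p.Prime] (W : WeierstrassCurve ℚ) [W.IsElliptic] [W.IsGloballyMinimal]
    (K : Type) [Field K] [NumberField K] (vbar : HeightOneSpectrum (𝓞 K))
    (κ₁ κ₂ : ZpExtension K p) (γ₁ γ₂ : absoluteGaloisGroup K) [Fact (ZpExtension.IsTopGeneratorPair κ₁ κ₂ γ₁ γ₂)]
    {N : ℕ} [NeZero N] (f : CuspForm (Gamma0 N) 2)
    (hN : (N : ℤ) = W.conductorNorm ℤ) (hp : p ≠ 2) (h5 : 5 ≤ p) (ha0 : W.frobeniusTrace p = 0)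
    (hIQ : IsImaginaryQuadratic K)
    (hsp : ((Ideal.span {(p : ℤ)}).primesOver (𝓞 K)).ncard = 2) (hcop : IsCoprime (N : ℤ) (NumberField.discr K))
    (hX : Rank1Residual.ClassX6 W p) {q₀ : ℕ} (hq₀ : q₀.Prime) (hqN : q₀ ∣ N) (hq2 : ¬ (q₀ ^ 2 ∣ N))
    (hin : ((Ideal.span {(q₀ : ℤ)}).primesOver (𝓞 K)).ncard = 1)
    (hspl : ∀ ℓ : ℕ, ℓ.Prime → ℓ ∣ N → ℓ ≠ q₀ → ((Ideal.span {(ℓ : ℤ)}).primesOver (𝓞 K)).ncard = 2)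
    (G : PowerSeries (PowerSeries (PadicComplexInt p))) (J : ℤ_[p] →+* PadicComplexInt p) (ε : ℤˣ)
    (hC' : ∃ xi Lsig : PowerSeries (PowerSeries (PadicComplexInt p)),
      (∃ (S : Brandt.XiSetup (N / q₀) q₀) (_ : Fintype (Brandt.ClassSet S.O))
          (φ : Brandt.ClassSet S.O → ℤ) (T : GrossPointTower K S p),
          φ ≠ 0 ∧
          Brandt.eigenLattice (N / q₀ * q₀) (Brandt.matrix S.O) (fun n => W.LFunction n) = ℤ ∙ φ ∧
          (T.HasMuZeroLAc p φ → GreenbergVatsal2000.HasUnitContent (UnrSeries₂.minus Lsig))) ∧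
      (Ideal.span {xi * G} =
          (WeierstrassCurve.XGr₂.charIdeal (W.baseChange K) p κ₁ κ₂ vbar γ₁ γ₂).map
              (IwasawaAlgebra₂.toUnr₂ p J) * Ideal.span {Lsig} ∧
      ∀ (κ : ZpExtension ℚ p) (γ : absoluteGaloisGroup ℚ), κ.IsCyclotomic → κ.IsTopGenerator γ →
        IsCyclotomicVariable p γ →
        (∃ ζ : ℤ_[p]ˣ, IsOfFinOrder ζ ∧
          GaloisRep.cyclotomicCharacter ℚ p γ * ζ = GaloisRep.cyclotomicCharacter K p γ₁) →
        ∀ (W₂ : WeierstrassCurve ℚ) [W₂.IsElliptic] [W₂.IsGloballyMinimal]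
          (C₂ : WeierstrassCurve.VariableChange ℚ),
          C₂ • W₂ = W.quadraticTwist (NumberField.discr K : ℚ) →
          (∀ (D₁ : Kobayashi2003.SignedSelmerDualData W κ γ ε)
              (D₂ : Kobayashi2003.SignedSelmerDualData W₂ κ γ ε) (g₁ g₂ : IwasawaAlgebra p),
              D₁.charIdeal = Ideal.span {g₁} → D₂.charIdeal = Ideal.span {g₂} →
              UnrSeries₂.plus xi ∣ PowerSeries.map J (g₁ * g₂)) ∧
          (∀ {N₂ : ℕ} [NeZero N₂] (f₂ : CuspForm (Gamma0 N₂) 2), IsNewformOf W₂ f₂ →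
            ∀ (L₁ L₂ : IwasawaAlgebra p), Kobayashi2003.IsSignedPAdicLFunction f p ε L₁ →
              Kobayashi2003.IsSignedPAdicLFunction f₂ p ε L₂ →
              ∃ u : PowerSeries (PadicComplexInt p), IsUnit u ∧
                UnrSeries₂.plus Lsig = u * PowerSeries.map J (L₁ * L₂)))) :
    ∃ xi Lsig : PowerSeries (PowerSeries (PadicComplexInt p)),
      GreenbergVatsal2000.HasUnitContent (UnrSeries₂.minus Lsig) ∧
      (Ideal.span {xi * G} =
          (WeierstrassCurve.XGr₂.charIdeal (W.baseChange K) p κ₁ κ₂ vbar γ₁ γ₂).map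
              (IwasawaAlgebra₂.toUnr₂ p J) * Ideal.span {Lsig} ∧
      ∀ (κ : ZpExtension ℚ p) (γ : absoluteGaloisGroup ℚ), κ.IsCyclotomic → κ.IsTopGenerator γ →
        IsCyclotomicVariable p γ →
        (∃ ζ : ℤ_[p]ˣ, IsOfFinOrder ζ ∧
          GaloisRep.cyclotomicCharacter ℚ p γ * ζ = GaloisRep.cyclotomicCharacter K p γ₁) →
        ∀ (W₂ : WeierstrassCurve ℚ) [W₂.IsElliptic] [W₂.IsGloballyMinimal]
          (C₂ : WeierstrassCurve.VariableChange ℚ),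
          C₂ • W₂ = W.quadraticTwist (NumberField.discr K : ℚ) →
          (∀ (D₁ : Kobayashi2003.SignedSelmerDualData W κ γ ε)
              (D₂ : Kobayashi2003.SignedSelmerDualData W₂ κ γ ε) (g₁ g₂ : IwasawaAlgebra p),
              D₁.charIdeal = Ideal.span {g₁} → D₂.charIdeal = Ideal.span {g₂} →
              UnrSeries₂.plus xi ∣ PowerSeries.map J (g₁ * g₂)) ∧
          (∀ {N₂ : ℕ} [NeZero N₂] (f₂ : CuspForm (Gamma0 N₂) 2), IsNewformOf W₂ f₂ →
            ∀ (L₁ L₂ : IwasawaAlgebra p), Kobayashi2003.IsSignedPAdicLFunction f p ε L₁ →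
              Kobayashi2003.IsSignedPAdicLFunction f₂ p ε L₂ →
              ∃ u : PowerSeries (PadicComplexInt p), IsUnit u ∧
                UnrSeries₂.plus Lsig = u * PowerSeries.map J (L₁ * L₂))) := by
  obtain ⟨xi, Lsig, ⟨S, _instF, φ, T, hφ0, hφ, hμ⟩, hP1, hline⟩ := hC'
  exact ⟨xi, Lsig,
    hμ (SemistableDefmuMuCarrier.hasMuZeroLAc_of_pollackWeston hPW W K hN hp ha0 hIQ hsp hcop hX hq₀ hqN hq2 hin hspl S φ
      hφ0 hφ (exists_not_dvd_weight_mul_apply S hφ0 hφ Fact.out h5) T),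
    hP1, hline⟩



/-- **The BODY of crux 2 `Theses.SignedLowerHalves.KobayashiLowerHalfSemistable` from the FIVE registered stub signatures of
skeleton v4 VERBATIM** (`h1a` = `stub_ramifiedLevelPrimeR`, `hC'` = `stub_definitePackageMuCarrier`, `hPW` = `stub_acMuInput`,
`h6` = `stub_namedInputsTwo`, `h7` = `stub_threeResidual`): for every globally minimal `W/ℚ` and prime `p ≠ 2` with `ClassX6 W p`,
`∃ ε, KobayashiLowerDivisibility W p ε`. The v2 stub Cμ is rebuilt pointwise from `hC'` (definite `μ`-carrier, v4: no normalisation clause) and `hPW`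
(Pollack–Weston Thm. 2.5 by name) by `exists_package_of_muCarrier` (v4; the Lemma 2.1 normalisation from `5 ≤ p` by §1); the rest is p630247's
`SemistableDefmuAssemblyStubs.kobayashiLowerHalfSemistable_body_of_stubs` (`5 ≤ p` via p629660, `p = 3` via `h7`).
CONDITIONAL; closes nothing; the item stays OPEN (PRE). [cite: BurungaleSkinnerTianWan2024, Thm. 1.3, §2.2.2–§2.3]
[cite: PollackWeston2011, Thm. 2.5 (i)] [cite: Kobayashi2003, Conjecture (Main Conjecture) (p. 2)] -/
theorem kobayashiLowerHalfSemistable_body_of_stubs₅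
    (h1a :
      ∀ (p : ℕ) [Fact p.Prime] (W : WeierstrassCurve ℚ) [W.IsElliptic] [W.IsGloballyMinimal],
        5 ≤ p → Rank1Residual.ClassX6 W p →
        ∃ q₀ : ℕ, q₀.Prime ∧ (q₀ : ℤ) ∣ W.conductorNorm ℤ ∧ ¬ ((p : ℤ) ∣ padicValRat q₀ W.Δ))
    (hC' :
      ∀ {p : ℕ} [Fact p.Prime] (ι : PadicAlgCl p ≃+* ℂ) (W : WeierstrassCurve ℚ) [W.IsElliptic]
        [W.IsGloballyMinimal] (K : Type) [Field K] [NumberField K] (v vbar : HeightOneSpectrum (𝓞 K))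
        (κ₁ κ₂ : ZpExtension K p) (γ₁ γ₂ : absoluteGaloisGroup K)
        [Fact (ZpExtension.IsTopGeneratorPair κ₁ κ₂ γ₁ γ₂)] {N : ℕ} [NeZero N] (f : CuspForm (Gamma0 N) 2)
        [NeZero (NumberField.discr K).natAbs],
        IsNewformOf W f → (N : ℤ) = W.conductorNorm ℤ → p ≠ 2 → ¬ (p : ℤ) ∣ W.conductorNorm ℤ →
        W.frobeniusTrace p = 0 →
        IsImaginaryQuadratic K → ((Ideal.span {(p : ℤ)}).primesOver (𝓞 K)).ncard = 2 →
        ((p : ℕ) : 𝓞 K) ∈ v.asIdeal → ((p : ℕ) : 𝓞 K) ∈ vbar.asIdeal → vbar ≠ v →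
        (∀ (w : InfinitePlace K) (k : 𝓞 K), k ∈ v.asIdeal ↔ ‖ι.symm (w.embedding (k : K))‖ < 1) →
        IsCoprime (N : ℤ) (NumberField.discr K) →
        -- ⟨definite-CR datum, rev 5: X6 at 5 ≤ p; ONE prime q₀ ∥ N inert in K, every other ℓ ∣ N split; `2` split or
        --  `2 ∣ N` ((spl) of BSTW Thm 9.24); (CR, RAMIFIED branch only) `p ∤ v_{q₀}(Δ_W)` (ρ̄ ramified at q₀, `p ∤ c_{q₀}`)⟩
        5 ≤ p → Rank1Residual.ClassX6 W p →
        ∀ q₀ : ℕ, q₀.Prime → q₀ ∣ N → ¬ (q₀ ^ 2 ∣ N) →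
          ((Ideal.span {(q₀ : ℤ)}).primesOver (𝓞 K)).ncard = 1 →
          (∀ ℓ : ℕ, ℓ.Prime → ℓ ∣ N → ℓ ≠ q₀ → ((Ideal.span {(ℓ : ℤ)}).primesOver (𝓞 K)).ncard = 2) →
          (((Ideal.span {(2 : ℤ)}).primesOver (𝓞 K)).ncard = 2 ∨ 2 ∣ N) →
          ¬ ((p : ℤ) ∣ padicValRat q₀ W.Δ) →
        (∀ ρ : ModPGaloisRep K (ZMod p) 2, (W.baseChange K).IsTorsionGaloisRep p ρ →
          FramedRep.IsAbsolutelyIrreducible ρ) →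
        κ₁.IsCyclotomic → κ₂.IsAnticyclotomic →
        ∀ (Ω δ : ℂ) (Ωp : (unrIntegers p)ˣ) (LK G : PowerSeries (PowerSeries (PadicComplexInt p))),
          Ω ≠ 0 → (δ ^ 2 = (NumberField.discr K : ℂ) ∨ δ ^ 2 = -(NumberField.discr K : ℂ)) →
          IsKatzMeasure₂ ι v vbar ∅ κ₁ κ₂ γ₁⁻¹ γ₂⁻¹ 1 Ω δ ((Ωp : unrIntegers p) : PadicComplex p) LK →
          IsGreenbergLFunctionAnyRoot₂ ι v vbar κ₁ κ₂ γ₁⁻¹ γ₂⁻¹ f (NumberField.discr K).natAbs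
            (NumberField.classNumber K) LK G →
        ∀ J : ℤ_[p] →+* PadicComplexInt p,
          (∀ x : ℤ_[p], ((J x : PadicComplexInt p) : PadicComplex p) = ((x : ℚ_[p]) : PadicComplex p)) →
        ∀ ε : ℤˣ,
        ∃ xi Lsig : PowerSeries (PowerSeries (PadicComplexInt p)),
          (∃ (S : Brandt.XiSetup (N / q₀) q₀) (_ : Fintype (Brandt.ClassSet S.O))
              (φ : Brandt.ClassSet S.O → ℤ) (T : GrossPointTower K S p),
              φ ≠ 0 ∧
              Brandt.eigenLattice (N / q₀ * q₀) (Brandt.matrix S.O) (fun n => W.LFunction n) = ℤ ∙ φ ∧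
              (T.HasMuZeroLAc p φ → GreenbergVatsal2000.HasUnitContent (UnrSeries₂.minus Lsig))) ∧
          (Ideal.span {xi * G} =
              (WeierstrassCurve.XGr₂.charIdeal (W.baseChange K) p κ₁ κ₂ vbar γ₁ γ₂).map
                  (IwasawaAlgebra₂.toUnr₂ p J) * Ideal.span {Lsig} ∧
          ∀ (κ : ZpExtension ℚ p) (γ : absoluteGaloisGroup ℚ), κ.IsCyclotomic → κ.IsTopGenerator γ →
            IsCyclotomicVariable p γ →
            (∃ ζ : ℤ_[p]ˣ, IsOfFinOrder ζ ∧
              GaloisRep.cyclotomicCharacter ℚ p γ * ζ = GaloisRep.cyclotomicCharacter K p γ₁) →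
            ∀ (W₂ : WeierstrassCurve ℚ) [W₂.IsElliptic] [W₂.IsGloballyMinimal]
              (C₂ : WeierstrassCurve.VariableChange ℚ),
              C₂ • W₂ = W.quadraticTwist (NumberField.discr K : ℚ) →
              (∀ (D₁ : Kobayashi2003.SignedSelmerDualData W κ γ ε)
                  (D₂ : Kobayashi2003.SignedSelmerDualData W₂ κ γ ε) (g₁ g₂ : IwasawaAlgebra p),
                  D₁.charIdeal = Ideal.span {g₁} → D₂.charIdeal = Ideal.span {g₂} →
                  UnrSeries₂.plus xi ∣ PowerSeries.map J (g₁ * g₂)) ∧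
              (∀ {N₂ : ℕ} [NeZero N₂] (f₂ : CuspForm (Gamma0 N₂) 2), IsNewformOf W₂ f₂ →
                ∀ (L₁ L₂ : IwasawaAlgebra p), Kobayashi2003.IsSignedPAdicLFunction f p ε L₁ →
                  Kobayashi2003.IsSignedPAdicLFunction f₂ p ε L₂ →
                  ∃ u : PowerSeries (PadicComplexInt p), IsUnit u ∧
                    UnrSeries₂.plus Lsig = u * PowerSeries.map J (L₁ * L₂))))
    (hPW :
      ∀ (K : Type) [Field K] [NumberField K] {Nplus Nminus : ℕ} (S : Brandt.XiSetup Nplus Nminus)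
        (p : ℕ) [Fact p.Prime] (W : WeierstrassCurve ℚ), pollackWeston2011_thm_2_5_hasMuZeroLAc K S p W)
    (h6 :
      (thm617_exists_isGreenbergLFunctionAnyRoot₂_supersingular_PRE ∧
        Kobayashi2003.thm12_signedSelmerDual_finite_torsion ∧ Kobayashi2003.thm41_signedCharIdeal_divisibility ∧
        nonempty_modularParametrizationData ∧ realPeriodRat_eq_unit_mul_plusPeriod) ∧
        thm924_greenberg_dvd_charIdealXGr₂_awayFromCyc_OPEN)
    (h7 :
      ∀ (W : WeierstrassCurve ℚ) [W.IsElliptic] [W.IsGloballyMinimal], Rank1Residual.ClassX6 W 3 →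
        ∃ ε : ℤˣ, Summit.BirchSwinnertonDyer.Rank1Residual.Supersingular.KobayashiLowerDivisibility W 3 ε) :
    ∀ (W : WeierstrassCurve ℚ) [W.IsElliptic] [W.IsGloballyMinimal] (p : ℕ) [Fact p.Prime], p ≠ 2 →
      Rank1Residual.ClassX6 W p →
      ∃ ε : ℤˣ, Summit.BirchSwinnertonDyer.Rank1Residual.Supersingular.KobayashiLowerDivisibility W p ε := by
  refine SemistableDefmuAssemblyStubs.kobayashiLowerHalfSemistable_body_of_stubs h1a ?_ h6 h7
  intro p _ ι W _ _ K _ _ v vbar κ₁ κ₂ γ₁ γ₂ _ N _ f _ hf hN hp hpN ha0 hIQ hsp hv hvbar hvv hι hcop h5 hX q₀ hq₀ hqN hq2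
    hin hspl h2K hCR hirr hκ₁ hκ₂ Ω δ Ωp LK G hΩ hδ hLK hGr J hJ ε
  exact exists_package_of_muCarrier hPW W K vbar κ₁ κ₂ γ₁ γ₂ f hN hp h5 ha0 hIQ hsp hcop hX hq₀ hqN hq2 hin hspl G J ε
    (hC' ι W K v vbar κ₁ κ₂ γ₁ γ₂ f hf hN hp hpN ha0 hIQ hsp hv hvbar hvv hι hcop h5 hX q₀ hq₀ hqN hq2 hin hspl h2K hCR
      hirr hκ₁ hκ₂ Ω δ Ωp LK G hΩ hδ hLK hGr J hJ ε)

end Summit.BirchSwinnertonDyer.BirchSwinnertonDyer.Theorems.SemistableDefmuMuCarrierV4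

end
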